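import Summits.QuantumFields.BalabanUV.T4Continuum.Support.NE7CurvedSupLetterBootstrap
import HarnessLib

/-!
# NE7CurvedSupLetter — THE CURVED SUP LETTER (L) OF THE ENERGY SLICE `𝒯_E(W)`: `∃ K ε₀ > 0` (functions of `d`, `L`, `card n`) such that for every `k`, `N`, every unitary `(L^{k+1}N)`-periodic
# `W` in the multi-level small-field class with `SmallField W x`, `(L^{k+1})²·x ≤ ε₀`, every `Y ∈ energyBlockLandauW L N (k+1) W` and every `B ≥ sup_{μ≠ν}‖curl_W Y‖`:
# `‖Y(y,κ)‖ ≤ K·L^{k+1}·B` — the hypothesis `hLet` of `NE7SliceStepContraction.split_error_sized` (memo ROAD-G100 §4), k- and N-UNIFORM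

Cell `pub-balaban`, rung (B)+1 sub-cell t4, lineage `b2b-balaban-t4-ne7-p1`, generation 101 (CRUX PROVER NE7 #1 = OWNER of BINDER row NE7).  Memo `t4/b2b-balaban-t4-ne7-p1-g101/ROAD-G101.md` §6.
THE BOOTSTRAP AT THE SUP-ATTAINING BOND `(y₀, κ₀)` (`S = ‖Y(y₀,κ₀)‖ = max‖Y‖`, `NE7SliceStepContraction.exists_bond_max`): gauge by the comb `u = btree M W (blk_M y₀ − C₃·𝟙)`, `C₃ = K_b + nbRad + 3`
(`(d+1)·2MC₃·x`-flat on the working region, `NE7CurvedSupLetterData.comb_near_flat`), cut off by `χ = AveragingDeficitLatticeH2Prep.chi 0 (M·K_b) y₀` (`χ(y₀) = 1`, support `box (M K_b) y₀`, `1∕(M K_b)`-Lipschitz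
per sup-step), `Z := χ•Y^u`; its three flat data (`NE7CurvedSupLetterData.curl_datum ∕ div_datum_uniform ∕ straight_datum_uniform`, the Lagrange multiplier `O(S∕M)` of
`NE7EnergySliceDivergenceSup.divergence_sup_le`) feed the compactly supported flat letter `NE7FlatSupLetterCompact.sup_flat_compact` on the cube `M•(blk y₀ − (K_b+6)𝟙) + [0, M(2K_b+12))^{d+1}`, which
reads `S = ‖Z(y₀,κ₀)‖ ≤ K·M·B + θ·S` with `θ ≤ 1∕8` once `K_b ≥ 32K + 16K′(d+1) + 16K′Γ₀ + 32K″` (the `1∕K_b` terms) and `M²x ≤ ε₀` (the `δ` and `loopRad` terms): `S ≤ 2K·M·B`.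
WHAT ([folklore]; 0 def, 0 sorry; dimension `d + 1 ≥ 2`, `L ≥ 2`, every `k`, every `N ≥ 1`).  **`curved_sup_letter`**.
HONEST FRAMING (page 1): a linear a-priori estimate on OUR typed slice (the analytic heart (L) of the supplier (S1) of memo ROAD-G100 §2), assembled BY NAME over gen 101's bricks and the NE7b seat's
junction files; constants existential (functions of `d`, `L`, `card n` through GAN24's letters); nothing of Bałaban's asserted ([B8] (1.38), [B5] (1.26) are TEXT LOCATIONS); NOT (S1), NOT (S2), NOT NE7;
spine 0∕9; finite T⁴ rung (B)+1 — NOT infinite volume, NOT mass gap, NOT BetaPertH, NOT Clay.  Continuum YM on T⁴ ⇐ BetaPertH ∧ nine spine estimates (0/9 proved); BetaPertH ⇐ (D1) ∧ (D4) ∧ CAP+tail;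
G-an2-4 gates asym, D1 and NE2/3/4.
-/

set_option autoImplicit false

open scoped BigOperators Matrix.Norms.L2Operator
open Finset

namespace Summit.QuantumFields.BalabanUV.T4Continuum.NE7CurvedSupLetter

open Literature.MathematicalPhysics.QuantumFieldTheory.Balaban1983to89
open B7Prop1Explicit B7Prop2Explicit
open T4AveragingDeficitWall (IsUnitaryCfg IsSkewDir SmallField Ad curlAt box)
open T4AveragingDeficitWallBoundary (IsPeriodicCfg periodBox)
open AveragingDeficitPeriodicCounting (IsPeriodicDir)
open AveragingDeficitCounting (mem_box_iff self_mem_box)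
open AveragingDeficitTransport (norm_Ad_of_unitary)
open AveragingDeficitMultiLevelPrep (LevelSmall tower)
open AveragingDeficitTwoLevelPrep (prop1Radius)
open AveragingDeficitLocality (dirGauge)
open AveragingDeficitBlockDensity (btree btree_mem)
open AveragingDeficitLatticeH2Prep (chi chi_nonneg chi_le_one chi_eq_one_of_mem chi_eq_zero_of_not_mem abs_chi_sub_chi_le_of_step)
open SpreadLift (loopRad)
open BlockAverageVaryHolo (nbRad)
open BlockAveragePushDirSplit (flat)
open NE3CoercivityScaling (flatDiv)
open NE3CovariantWeitzenbock (covDiv)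
open NE3CovariantLineSumsError (Csup Csup_nonneg iterate_prop1Radius_nonneg)
open NE3TangentCovariantTower (QbarIter)
open NE3QbarIterCovLiftPrep (sum_pow_le_pow_real sum_loopRad_iterate_le)
open NE3TopRadiusLetters (loopRad_iterate_le_of_levelSmall)
open SmoothRefineBlocks (blk res blk_add_res res_nonneg res_le)
open NE7MeanZeroGaugeSliceW (energyBlockLandauW)
open NE7EnergySliceLocalForm (covDiv_eq_nestedExt_of_mem)
open NE7EnergySliceDivergenceSup (divergence_sup_le)
open NE7LocalStraightDatumLetter (norm_dirGauge_le)
open NE7CurvedSupLetterData (comb_near_flat ball_near_flat curl_datum div_datum_uniform straight_datum_uniform support_of_cutoff)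
open NE7FlatSupLetterCompact (sup_flat_compact)
open NE7SliceStepContraction (exists_bond_max)

noncomputable section

variable {d : ℕ} {n : Type*} [Fintype n] [DecidableEq n]

open NE7CurvedSupLetterBootstrap (bootstrap_at_point)

set_option maxHeartbeats 400000 in
/-- **THE CURVED SUP LETTER (L)** (dimension `d + 1 ≥ 2`, `L ≥ 2`): `∃ K > 0, ∃ ε₀ > 0` (functions of `d`, `L`, `card n`) such that for every `k`, `N ≥ 1`, every unitary `W` of period
`tower L N (k+1)` in the multi-level small-field class with `SmallField W x` and `(L^{k+1})²·x ≤ ε₀`, every `Y ∈ energyBlockLandauW L N (k+1) W` and every `B` bounding `‖curlAt W Y z μ ν‖` off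
the diagonal: `‖Y y κ‖ ≤ K·L^{k+1}·B`. [folklore] -/
theorem curved_sup_letter [Nonempty n] (hd : 1 ≤ d) {L : ℕ} (hL : 2 ≤ L) :
    ∃ K : ℝ, 0 < K ∧ ∃ ε₀ : ℝ, 0 < ε₀ ∧ ∀ (k N : ℕ) [NeZero N] (W : Site (d + 1) → Fin (d + 1) → (Matrix n n ℂ)ˣ) (x : ℝ),
      IsUnitaryCfg W → IsPeriodicCfg W ((tower L N (k + 1) : ℕ) : ℤ) → 0 ≤ x → LevelSmall (d + 1) L k x → SmallField W x →
      ((L : ℝ) ^ (k + 1)) ^ 2 * x ≤ ε₀ →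
      ∀ Y ∈ energyBlockLandauW (d := d + 1) (n := n) L N (k + 1) W, ∀ (B : ℝ),
        (∀ (z : Site (d + 1)) (μ ν : Fin (d + 1)), μ ≠ ν → ‖curlAt W Y z μ ν‖ ≤ B) →
        ∀ (y : Site (d + 1)) (κ : Fin (d + 1)), ‖Y y κ‖ ≤ K * (L : ℝ) ^ (k + 1) * B := by
  obtain ⟨K, hK, K', hK', K'', hK'', hboot⟩ := bootstrap_at_point (d := d) (n := n) hd
  -- the constants (opaque, with their defining equations)
  have hL1 : 1 ≤ L := by omega
  have hLr1 : (1 : ℝ) ≤ L := by exact_mod_cast hL1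
  obtain ⟨d', hd'⟩ : ∃ d' : ℝ, d' = ((d + 1 : ℕ) : ℝ) := ⟨_, rfl⟩
  have hd'1 : (1 : ℝ) ≤ d' := by rw [hd']; exact_mod_cast (by omega : 1 ≤ d + 1)
  have hd'0 : (0 : ℝ) ≤ d' := by linarith
  obtain ⟨Γ₀, hΓ₀⟩ : ∃ Γ₀ : ℝ, Γ₀ = 2 * (2 * d' + 4 * d' * d) := ⟨_, rfl⟩
  have hΓ₀0 : 0 ≤ Γ₀ := by rw [hΓ₀]; positivity
  obtain ⟨cℓ, hcℓ⟩ : ∃ cℓ : ℝ, cℓ = 4 / 3 * (17 * ((d' + 1) * (d' + 4))) := ⟨_, rfl⟩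
  have hcℓ0 : 0 ≤ cℓ := by rw [hcℓ]; positivity
  obtain ⟨A, hA⟩ : ∃ A : ℝ, A = (2 * d' + 4) * (L : ℝ) ^ 2 := ⟨_, rfl⟩
  have hA0 : 0 ≤ A := by rw [hA]; positivity
  obtain ⟨Bc, hBc⟩ : ∃ Bc : ℝ, Bc = 8 * (L : ℝ) + Csup (d + 1) L := ⟨_, rfl⟩
  have hBc0 : 0 ≤ Bc := by rw [hBc]; have := Csup_nonneg (d + 1) L; positivity
  -- the cut-off scale in blocks: kills the `1∕K_b` terms
  obtain ⟨Kb, hKb1, hKbr⟩ : ∃ Kb : ℕ, 1 ≤ Kb ∧ 32 * K + 16 * K' * d' + 16 * K' * Γ₀ + 32 * K'' ≤ (Kb : ℝ) :=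
    ⟨⌈32 * K + 16 * K' * d' + 16 * K' * Γ₀ + 32 * K''⌉₊ + 1, by omega, by push_cast; exact (Nat.le_ceil _).trans (by linarith)⟩
  have hKb0 : (0 : ℝ) < Kb := by exact_mod_cast (by omega : 0 < Kb)
  obtain ⟨C₃, hC₃⟩ : ∃ C₃ : ℕ, C₃ = Kb + nbRad (d + 1) L + 3 := ⟨_, rfl⟩
  obtain ⟨cδ, hcδ⟩ : ∃ cδ : ℝ, cδ = 2 * d' * (C₃ : ℝ) := ⟨_, rfl⟩
  have hcδ0 : 0 ≤ cδ := by rw [hcδ]; positivity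
  -- the smallness of `ε = M²x`: kills the `δ` and `loopRad` terms
  obtain ⟨E, hE⟩ : ∃ E : ℝ, E = 1 + (256 * K * cδ + 32 * K' * d' * cδ + 64 * K' * d' * (L : ℝ) * Γ₀ * (cδ + 2 * cℓ) + 32 * K'' * (A * cδ + (2 * A + Bc) * cℓ)
    + 2 * (4 * d' ^ 2 + 16 * d' * (17 * ((d' + 1) * (d' + 4)))) + 4 * d' * (L : ℝ) * (cδ + 2 * cℓ)) := ⟨_, rfl⟩
  have hE1 : 1 ≤ E := by rw [hE]; exact le_add_of_nonneg_right (by positivity)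
  have hE0 : 0 < E := by linarith
  refine ⟨2 * K, by positivity, 1 / E, by positivity, ?_⟩
  intro k N _ W x hWu hWP hx hs hWx hε Y hY B hB y κ
  -- sizes
  have hN1 : 1 ≤ N := Nat.one_le_iff_ne_zero.mpr (NeZero.ne N)
  haveI : NeZero L := ⟨by omega⟩
  have hM1 : 1 ≤ L ^ (k + 1) := Nat.one_le_pow _ _ hL1
  obtain ⟨Mr, hMr⟩ : ∃ Mr : ℝ, Mr = (L : ℝ) ^ (k + 1) := ⟨_, rfl⟩
  have hMrc : ((L ^ (k + 1) : ℕ) : ℝ) = Mr := by rw [hMr]; push_cast; ring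
  have hMz : ((L ^ (k + 1) : ℕ) : ℤ) = (L : ℤ) ^ (k + 1) := by push_cast; ring
  have hMr1 : 1 ≤ Mr := by rw [← hMrc]; exact_mod_cast hM1
  have hMr0 : 0 < Mr := by linarith
  have hMz1 : (1 : ℤ) ≤ ((L ^ (k + 1) : ℕ) : ℤ) := by exact_mod_cast hM1
  have hLk : (L : ℝ) ^ k ≤ Mr := by
    rw [hMr, pow_succ]
    have := mul_le_mul_of_nonneg_left hLr1 (pow_nonneg (by positivity : (0:ℝ) ≤ L) k)
    linarith only [this]
  obtain ⟨ε, hεdef⟩ : ∃ ε : ℝ, ε = Mr ^ 2 * x := ⟨_, rfl⟩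
  have hε0 : 0 ≤ ε := by rw [hεdef]; exact mul_nonneg (pow_nonneg hMr0.le 2) hx
  have hεE : ε * E ≤ 1 := by rw [hεdef, hMr]; rwa [le_div_iff₀ hE0] at hε
  have hε1 : ε ≤ 1 := by have := mul_le_mul_of_nonneg_left hE1 hε0; linarith only [this, hεE]
  -- the sup is attained
  have hdpos : 0 < d + 1 := by omega
  have hP1 : 1 ≤ tower L N (k + 1) := Nat.one_le_iff_ne_zero.mpr (NeZero.ne _)
  obtain ⟨y₀, κ₀, hmax⟩ := exists_bond_max hdpos hP1 hY.2.1
  obtain ⟨S, hSdef⟩ : ∃ S : ℝ, S = ‖Y y₀ κ₀‖ := ⟨_, rfl⟩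
  have hS0 : 0 ≤ S := by rw [hSdef]; exact norm_nonneg _
  have hS : ∀ w μ, ‖Y w μ‖ ≤ S := fun w μ => by rw [hSdef]; exact hmax w μ
  have hμν : (⟨0, by omega⟩ : Fin (d + 1)) ≠ ⟨1, by omega⟩ := by simp [Fin.ext_iff]
  have hB0 : 0 ≤ B := (norm_nonneg _).trans (hB 0 _ _ hμν)
  suffices hmain : S ≤ K * Mr * B + 1 / 2 * S by
    have : S ≤ 2 * K * Mr * B := by linarith
    rw [hMr] at this
    exact (hS y κ).trans (by linarith)
  -- the bootstrap data sizes
  obtain ⟨δs, hδs⟩ : ∃ δs : ℝ, δs = (((d + 1 : ℕ) : ℝ) * ((((2 * (L ^ (k + 1) * C₃) + 1 : ℕ) : ℝ)) - 1)) * x := ⟨_, rfl⟩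
  have hδs0 : 0 ≤ δs := by
    rw [hδs]
    refine mul_nonneg (mul_nonneg (by positivity) ?_) hx
    have : (1 : ℝ) ≤ (((2 * (L ^ (k + 1) * C₃) + 1 : ℕ)) : ℝ) := by exact_mod_cast (by omega : 1 ≤ 2 * (L ^ (k + 1) * C₃) + 1)
    linarith
  have hMδs : Mr * δs = cδ * ε := by
    rw [hδs, hcδ, hεdef, hd', hMr]; push_cast; ring
  obtain ⟨g₁, hg₁⟩ : ∃ g₁ : ℝ, g₁ = 1 / ((L ^ (k + 1) * Kb : ℕ) : ℝ) := ⟨_, rfl⟩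
  have hg₁0 : 0 ≤ g₁ := by rw [hg₁]; positivity
  obtain ⟨q, hq⟩ : ∃ q : ℝ, q = 1 / (Kb : ℝ) := ⟨_, rfl⟩
  have hq0 : 0 ≤ q := by rw [hq]; positivity
  have hKq : (32 * K + 16 * K' * d' + 16 * K' * Γ₀ + 32 * K'') * q ≤ 1 := by
    rw [hq, ← div_eq_mul_one_div, div_le_one hKb0]; exact hKbr
  have hMg₁ : Mr * g₁ = q := by
    have hMKr : ((L ^ (k + 1) * Kb : ℕ) : ℝ) = Mr * Kb := by rw [hMr]; push_cast; ring
    rw [hg₁, hMKr, hq, one_div, mul_inv, ← mul_assoc, mul_inv_cancel₀ hMr0.ne', one_mul, one_div]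
  obtain ⟨G, hGdef⟩ : ∃ G : ℝ, G = 2 * (2 * ((d + 1 : ℕ) : ℝ) + 4 * ((d + 1 : ℕ) : ℝ) * ((((d + 1 : ℕ) : ℝ)) - 1) * (((L : ℝ) ^ (k + 1)) ^ 2 * x)) * S / (L : ℝ) ^ (k + 1) :=
    ⟨_, rfl⟩
  have hMG : Mr * G ≤ Γ₀ * S := by
    rw [hGdef, ← hMr, ← hεdef, ← hd', hΓ₀]
    have hdd : d' - 1 = (d : ℝ) := by rw [hd']; push_cast; ring
    rw [hdd]
    have : 2 * (2 * d' + 4 * d' * (d : ℝ) * ε) ≤ 2 * (2 * d' + 4 * d' * d) := by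
      have hdd0 : 0 ≤ d' * (d : ℝ) := mul_nonneg hd'0 (Nat.cast_nonneg d)
      have := mul_le_mul_of_nonneg_left hε1 hdd0
      linarith only [this]
    rw [mul_div_assoc', mul_comm Mr, mul_div_assoc, div_self hMr0.ne', mul_one]
    exact mul_le_mul_of_nonneg_right this hS0
  have hG0 : 0 ≤ G := by
    rw [hGdef, ← hMr]
    refine div_nonneg (mul_nonneg (mul_nonneg (by norm_num) ?_) hS0) hMr0.le
    have : (1 : ℝ) ≤ ((d + 1 : ℕ) : ℝ) := by rw [← hd']; exact hd'1
    have h2 : 0 ≤ ((d + 1 : ℕ) : ℝ) - 1 := by linarith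
    have h3 : 0 ≤ Mr ^ 2 * x := mul_nonneg (pow_nonneg hMr0.le 2) hx
    have h4 : 0 ≤ ((d + 1 : ℕ) : ℝ) := by linarith
    have := mul_nonneg (mul_nonneg (mul_nonneg (by norm_num : (0:ℝ) ≤ 4) h4) h2) h3
    linarith
  -- THE LAGRANGE MULTIPLIER IS `O(S∕M)` (B1)
  have hθB1 : 4 * (((d + 1 : ℕ) : ℝ)) ^ 2 * ((L : ℝ) ^ (k + 1) - 1) ^ 2 * x + 16 * ((d + 1 : ℕ) : ℝ) * loopRad (d + 1) L ((prop1Radius (d + 1) L)^[k] x) ≤ 1 / 2 := by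
    have hl := loopRad_iterate_le_of_levelSmall (d := d + 1) hL k hx hs
    have h1 : ((L : ℝ) ^ (k + 1) - 1) ^ 2 * x ≤ ε := by
      rw [hεdef, hMr]; exact mul_le_mul_of_nonneg_right (by nlinarith only [hMr1, hMr]) hx
    have hE2 : 2 * (4 * d' ^ 2 + 16 * d' * (17 * ((d' + 1) * (d' + 4)))) * ε ≤ 1 := by
      have hle : 2 * (4 * d' ^ 2 + 16 * d' * (17 * ((d' + 1) * (d' + 4)))) ≤ E := by
        rw [hE]
        have : 0 ≤ 256 * K * cδ + 32 * K' * d' * cδ + 64 * K' * d' * (L : ℝ) * Γ₀ * (cδ + 2 * cℓ) + 32 * K'' * (A * cδ + (2 * A + Bc) * cℓ) := by positivity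
        have : 0 ≤ 4 * d' * (L : ℝ) * (cδ + 2 * cℓ) := by positivity
        linarith
      have := mul_le_mul_of_nonneg_left hle hε0
      linarith only [this, hεE]
    rw [← hd'] at hl ⊢
    rw [← hMr, ← hεdef] at hl
    have hl' := mul_le_mul_of_nonneg_left hl (by positivity : (0 : ℝ) ≤ 16 * d')
    have h1' := mul_le_mul_of_nonneg_left h1 (by positivity : (0 : ℝ) ≤ 4 * d' ^ 2)
    linarith only [hl', h1', hE2]
  -- the level sum `σ`
  obtain ⟨σs, hσs⟩ : ∃ σs : ℝ, σs = ∑ i ∈ Finset.range (k + 1), ((L : ℝ) ^ i * δs + 2 * loopRad (d + 1) L ((prop1Radius (d + 1) L)^[i] x)) := ⟨_, rfl⟩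
  have hσs_le : σs ≤ (cδ + 2 * cℓ) * ε := by
    have h1 : (∑ i ∈ Finset.range (k + 1), (L : ℝ) ^ i * δs) ≤ Mr * δs := by
      rw [← Finset.sum_mul, hMr]; exact mul_le_mul_of_nonneg_right (sum_pow_le_pow_real hL (k + 1)) hδs0
    have h2 : (∑ i ∈ Finset.range (k + 1), 2 * loopRad (d + 1) L ((prop1Radius (d + 1) L)^[i] x)) ≤ 2 * (cℓ * ε) := by
      rw [← Finset.mul_sum]
      refine mul_le_mul_of_nonneg_left ?_ (by norm_num)
      have hl := (sum_loopRad_iterate_le (d := d + 1) hL hx k).trans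
        (mul_le_mul_of_nonneg_left (loopRad_iterate_le_of_levelSmall (d := d + 1) hL k hx hs) (by norm_num))
      rw [hcℓ, hεdef, hMr, hd']; exact hl.trans (le_of_eq (by ring))
    rw [hσs, Finset.sum_add_distrib, hMδs] at *
    rw [hMδs] at h1
    linarith only [h1, h2]
  have hσs0 : 0 ≤ σs := by
    rw [hσs]; exact Finset.sum_nonneg fun i _ => by
      have hr := iterate_prop1Radius_nonneg (d := d + 1) (L := L) i hx
      have hl : 0 ≤ loopRad (d + 1) L ((prop1Radius (d + 1) L)^[i] x) := by unfold loopRad; positivity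
      have hp : (0 : ℝ) ≤ (L : ℝ) ^ i := by positivity
      have := mul_nonneg hp hδs0; linarith only [this, hl]
  have hσcond : 2 * ((((d + 1 : ℕ) : ℝ)) * ((L : ℝ) - 1)) * σs ≤ 1 / 2 := by
    have hE3 : 4 * d' * (L : ℝ) * (cδ + 2 * cℓ) * ε ≤ 1 := by
      have hle : 4 * d' * (L : ℝ) * (cδ + 2 * cℓ) ≤ E := by
        rw [hE]
        have : 0 ≤ 256 * K * cδ + 32 * K' * d' * cδ + 64 * K' * d' * (L : ℝ) * Γ₀ * (cδ + 2 * cℓ) + 32 * K'' * (A * cδ + (2 * A + Bc) * cℓ) := by positivity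
        have : 0 ≤ 2 * (4 * d' ^ 2 + 16 * d' * (17 * ((d' + 1) * (d' + 4)))) := by positivity
        linarith
      have := mul_le_mul_of_nonneg_left hle hε0
      linarith only [this, hεE]
    have hdL : 0 ≤ d' * (L : ℝ) := mul_nonneg hd'0 (by positivity)
    have t := mul_le_mul_of_nonneg_left hσs_le hdL
    have u : d' * ((L : ℝ) - 1) * σs ≤ d' * (L : ℝ) * σs := by
      have := mul_nonneg hd'0 hσs0; linarith only [this]
    rw [← hd']
    linarith only [t, u, hE3]
  -- THE BOOTSTRAP
  have key := hboot hL k N W x hWu hWP hx hs hWx Y hY B hB0 hB S hS0 hS y₀ κ₀ Kb C₃ hKb1 hC₃ δs g₁ G σs hδs hg₁ hGdef hσs hθB1 hσcond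
  rw [← hSdef, ← hMr] at key
  -- ABSORPTION
  have hMgq : (((L ^ (k + 1) - 1 : ℕ)) : ℝ) * g₁ ≤ q := by
    rw [← hMg₁]
    refine mul_le_mul_of_nonneg_right ?_ hg₁0
    rw [← hMrc]; exact_mod_cast Nat.sub_le _ _
  have h2Mgq : ((((2 * (L ^ (k + 1) - 1) : ℕ)) : ℝ)) * g₁ ≤ 2 * q := by
    have : ((((2 * (L ^ (k + 1) - 1) : ℕ)) : ℝ)) = 2 * (((L ^ (k + 1) - 1 : ℕ)) : ℝ) := by push_cast; ring
    rw [this, mul_assoc]; linarith only [hMgq]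
  -- (a) the curl term
  have hT1 : Mr * (K * (B + 16 * δs * S + 2 * g₁ * S)) = K * Mr * B + 16 * K * (cδ * ε) * S + 2 * K * q * S := by
    rw [← hMδs, ← hMg₁]; ring
  -- (b) the divergence term
  have hT2 : Mr * (K' * (((d + 1 : ℕ) : ℝ) * g₁ * S + (((d + 1 : ℕ) : ℝ) * (2 * δs * S) + 4 * ((((d + 1 : ℕ) : ℝ)) * ((L : ℝ) - 1)) * σs * G)
      + (((L ^ (k + 1) - 1 : ℕ)) : ℝ) * g₁ * G))
      ≤ K' * (d' * q * S + 2 * d' * (cδ * ε) * S + 4 * d' * (L : ℝ) * ((cδ + 2 * cℓ) * ε) * (Γ₀ * S) + q * (Γ₀ * S)) := by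
    rw [← hd']
    have e : Mr * (K' * (d' * g₁ * S + (d' * (2 * δs * S) + 4 * (d' * ((L : ℝ) - 1)) * σs * G) + (((L ^ (k + 1) - 1 : ℕ)) : ℝ) * g₁ * G))
        = K' * (d' * (Mr * g₁) * S + 2 * d' * (Mr * δs) * S + 4 * d' * ((L : ℝ) - 1) * σs * (Mr * G) + ((((L ^ (k + 1) - 1 : ℕ)) : ℝ) * g₁) * (Mr * G)) := by ring
    rw [e, hMg₁, hMδs]
    refine mul_le_mul_of_nonneg_left ?_ hK'.le
    have hMG0 : 0 ≤ Mr * G := mul_nonneg hMr0.le hG0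
    have t3 : 4 * d' * ((L : ℝ) - 1) * σs * (Mr * G) ≤ 4 * d' * (L : ℝ) * ((cδ + 2 * cℓ) * ε) * (Γ₀ * S) := by
      have a1 : 4 * d' * ((L : ℝ) - 1) ≤ 4 * d' * (L : ℝ) := by linarith only [hd'0]
      have a0 : 0 ≤ 4 * d' * ((L : ℝ) - 1) := by
        have : 0 ≤ d' * ((L : ℝ) - 1) := mul_nonneg hd'0 (by linarith only [hLr1]); linarith only [this]
      calc 4 * d' * ((L : ℝ) - 1) * σs * (Mr * G) ≤ 4 * d' * (L : ℝ) * σs * (Mr * G) := by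
            have := mul_le_mul_of_nonneg_right (mul_le_mul_of_nonneg_right a1 hσs0) hMG0; linarith only [this]
        _ ≤ 4 * d' * (L : ℝ) * ((cδ + 2 * cℓ) * ε) * (Mr * G) := by
            have h4 : 0 ≤ 4 * d' * (L : ℝ) := by positivity
            exact mul_le_mul_of_nonneg_right (mul_le_mul_of_nonneg_left hσs_le h4) hMG0
        _ ≤ 4 * d' * (L : ℝ) * ((cδ + 2 * cℓ) * ε) * (Γ₀ * S) := by
            have h5 : 0 ≤ 4 * d' * (L : ℝ) * ((cδ + 2 * cℓ) * ε) := by positivity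
            exact mul_le_mul_of_nonneg_left hMG h5
    have t4 : ((((L ^ (k + 1) - 1 : ℕ)) : ℝ) * g₁) * (Mr * G) ≤ q * (Γ₀ * S) :=
      mul_le_mul hMgq hMG hMG0 hq0
    linarith only [t3, t4]
  -- (c) the straight datum term
  have e3 : (2 * (((d + 1 : ℕ) : ℝ)) + 4) * (L : ℝ) ^ 2 * (Mr * δs)
      + (2 * ((2 * (((d + 1 : ℕ) : ℝ)) + 4) * (L : ℝ) ^ 2) + (8 * (L : ℝ) + Csup (d + 1) L))
        * (4 / 3 * (17 * (((((d + 1 : ℕ) : ℝ)) + 1) * ((((d + 1 : ℕ) : ℝ)) + 4)) * (Mr ^ 2 * x)))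
      = A * (cδ * ε) + (2 * A + Bc) * (cℓ * ε) := by
    rw [hMδs, ← hεdef, hA, hBc, hcℓ, hd']; ring
  have hT3 : K'' * (((L ^ (k + 1) : ℕ) : ℝ) * ((((2 * (L ^ (k + 1) - 1) : ℕ)) : ℝ) * g₁ * S)
      + (L : ℝ) ^ k * (2 * S) * ((2 * (((d + 1 : ℕ) : ℝ)) + 4) * (L : ℝ) ^ 2 * (Mr * δs)
        + (2 * ((2 * (((d + 1 : ℕ) : ℝ)) + 4) * (L : ℝ) ^ 2) + (8 * (L : ℝ) + Csup (d + 1) L))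
          * (4 / 3 * (17 * (((((d + 1 : ℕ) : ℝ)) + 1) * ((((d + 1 : ℕ) : ℝ)) + 4)) * (Mr ^ 2 * x))))) / Mr
      ≤ K'' * (2 * q * S + 2 * S * (A * (cδ * ε) + (2 * A + Bc) * (cℓ * ε))) := by
    rw [e3, hMrc, mul_div_assoc]
    refine mul_le_mul_of_nonneg_left ?_ hK''.le
    rw [add_div, mul_div_cancel_left₀ _ hMr0.ne']
    have hc2 : 0 ≤ A * (cδ * ε) + (2 * A + Bc) * (cℓ * ε) := by positivity
    have s1 : ((((2 * (L ^ (k + 1) - 1) : ℕ)) : ℝ)) * g₁ * S ≤ 2 * q * S := mul_le_mul_of_nonneg_right h2Mgq hS0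
    have s2 : (L : ℝ) ^ k * (2 * S) * (A * (cδ * ε) + (2 * A + Bc) * (cℓ * ε)) / Mr ≤ 2 * S * (A * (cδ * ε) + (2 * A + Bc) * (cℓ * ε)) := by
      rw [div_le_iff₀ hMr0]
      have h1 : (L : ℝ) ^ k * (2 * S) * (A * (cδ * ε) + (2 * A + Bc) * (cℓ * ε)) ≤ Mr * (2 * S) * (A * (cδ * ε) + (2 * A + Bc) * (cℓ * ε)) :=
        mul_le_mul_of_nonneg_right (mul_le_mul_of_nonneg_right hLk (by positivity)) hc2
      have h2 : Mr * (2 * S) * (A * (cδ * ε) + (2 * A + Bc) * (cℓ * ε)) ≤ 2 * S * (A * (cδ * ε) + (2 * A + Bc) * (cℓ * ε)) * Mr := by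
        nlinarith only [hMr1, hS0, hc2]
      exact h1.trans h2
    linarith only [s1, s2]
  -- the two groups
  have hKgrp : (2 * K + K' * d' + K' * Γ₀ + 2 * K'') * q ≤ 1 / 16 := by linarith only [hKq]
  have hεgrp : (16 * K * cδ + 2 * K' * d' * cδ + 4 * K' * d' * (L : ℝ) * Γ₀ * (cδ + 2 * cℓ) + 2 * K'' * (A * cδ + (2 * A + Bc) * cℓ)) * ε ≤ 1 / 16 := by
    have hle : 16 * (16 * K * cδ + 2 * K' * d' * cδ + 4 * K' * d' * (L : ℝ) * Γ₀ * (cδ + 2 * cℓ) + 2 * K'' * (A * cδ + (2 * A + Bc) * cℓ)) ≤ E := by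
      rw [hE]
      have : 0 ≤ 2 * (4 * d' ^ 2 + 16 * d' * (17 * ((d' + 1) * (d' + 4)))) := by positivity
      have : 0 ≤ 4 * d' * (L : ℝ) * (cδ + 2 * cℓ) := by positivity
      linarith
    have := mul_le_mul_of_nonneg_left hle hε0
    linarith only [this, hεE]
  have hKS := mul_le_mul_of_nonneg_left hKgrp hS0
  have hεS := mul_le_mul_of_nonneg_left hεgrp hS0
  have hsum : Mr * (K * (B + 16 * δs * S + 2 * g₁ * S) + K' * (((d + 1 : ℕ) : ℝ) * g₁ * S + (((d + 1 : ℕ) : ℝ) * (2 * δs * S) + 4 * ((((d + 1 : ℕ) : ℝ)) * ((L : ℝ) - 1)) * σs * G)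
      + (((L ^ (k + 1) - 1 : ℕ)) : ℝ) * g₁ * G))
      ≤ (K * Mr * B + 16 * K * (cδ * ε) * S + 2 * K * q * S)
        + K' * (d' * q * S + 2 * d' * (cδ * ε) * S + 4 * d' * (L : ℝ) * ((cδ + 2 * cℓ) * ε) * (Γ₀ * S) + q * (Γ₀ * S)) := by
    rw [mul_add, hT1]; linarith only [hT2]
  linear_combination key + hsum + hT3 + hKS + hεS + (3 / 8 : ℝ) * hS0

end

end Summit.QuantumFields.BalabanUV.T4Continuum.NE7CurvedSupLetter
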